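import Literature.Geometry.Kaehler.ComplexTorusLefschetzGroupClassicalFactorsAlbertTypes
import Literature.Geometry.Kaehler.ComplexTorusAlbertTypeIIILefschetzGroupComponentGroup
import Literature.Geometry.Kaehler.ComplexTorusLefschetzGroupConnectedNoTypeIII
import HarnessLib

/-!
# Milne's Summary table assembled, the identity component: for every simple polarised complex torus of dimension
# `g ≤ 7`, Lange's `Lf(X)(ℂ) = S(X)(ℂ)⁰` is `f` copies of a CONNECTED classical group — `Sp_{2g/f}(ℂ)` (type I),
# `Sp_{g/f}(ℂ)` (type II), `SO_{g/f}(ℂ)` (type III), `GL_{g/(df)}(ℂ)` (type IV) — and `[S(X)(ℂ) : Lf(X)(ℂ)]` is `1`,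
# except `2^f` for type III

Layer `Literature/Geometry/Kaehler`, namespace `Literature.Geometry.Kaehler.ComplexTorus`; lane `lit-hodgefound`
(Track 2 foundations library), Layer A4 (Lefschetz groups), prover seat `lit-hodgefound-p17` (generation 63),
self-proposed row g63-#4 — the identity-component twin of g62-#5 ∕ #9
`ComplexTorusLefschetzGroupClassicalFactorsAlbertTypes` (`IsSimple.lefschetzGroupC_classicalPowers_of_finrank_le_seven`:
the «Group» column `S(X)(ℂ) ≃* Sp^f ∕ Sp^f ∕ O^f ∕ GL^f` for `g ≤ 7`), BY NAME on g61-#2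
`ComplexTorusAlbertTypeILefschetzGroupSymplecticFactors` (`IsSimple.nonempty_lefschetzIdentityC_mulEquiv_pi_symplecticGroupC_of_isAlbertTypeI`),
g62-#7 `ComplexTorusAlbertTypeIILefschetzGroupSymplecticFactors`
(`IsSimple.nonempty_lefschetzIdentityC_mulEquiv_fun_symplecticGroupC_of_isAlbertTypeII`), g63-#2
`ComplexTorusAlbertTypeIIILefschetzIdentitySpecialOrthogonalFactors`
(`IsSimple.nonempty_lefschetzIdentityC_mulEquiv_fun_specialOrthogonalGroup_of_isAlbertTypeIII`), g63-#3
`ComplexTorusAlbertTypeIIILefschetzGroupComponentGroup` (`IsSimple.relIndex_lefschetzIdentityC_lefschetzGroupC_of_isAlbertTypeIII`),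
g62-#8 `ComplexTorusAlbertTypeIVLefschetzGroupLinearFactors`
(`IsSimple.nonempty_lefschetzIdentityC_mulEquiv_fun_generalLinearGroup_of_isAlbertTypeIV`), skel-4's
`ComplexTorusLefschetzGroupConnectedNoTypeIII` (`IsSimple.lefschetzIdentityC_eq_lefschetzGroupC_iff_not_isAlbertTypeIII'`)
and p12's `ComplexTorusAlbertClassificationLowDimension` (Albert's theorem for `g ≤ 7`).  THEOREMS ONLY (no
definition, no instance, no notation, no named fact; D-0026, net debt 0).

## Sources, verbatim

* J. S. Milne, *Lefschetz classes on abelian varieties*, Duke Math. J. **96** (1999) 639–675 (held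
  `paper:doi-10-1215-s0012-7094-99-09620-5`), §2 Summary, p. 652 (p0014 L5–L37): «The following table summarizes
  the properties of the reductive groups `S(A)`. Type ∣ Group ∣ Semisimple ∣ Connected ∣ Dimension ∣ Rank: I ∣
  `Sp_{2g/f}` ∣ Yes ∣ Yes […] II ∣ `Sp_{g/f}` ∣ Yes ∣ Yes […] III ∣ `O_{g/f}` ∣ Yes ∣ No […] IV ∣ `GL_{g/(df)}` ∣ No ∣
  Yes […] The group `S(A)_{/k^al}` is isomorphic to `f` copies of the group listed in the second column»; §4,
  p. 660–661 (Remark 4.9): «`S(A)` is not [connected]—see the table at the end of Section 2 […] The class `c` is fixed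
  by the identity component of `S(A)` but not by `S(A)` itself».
* T. A. Springer, *Linear Algebraic Groups*, 2nd ed. (1998), Exercise 2.2.2 (2)(b): «Show that `SO_n` is the identity
  component of `O_n`»; Exercise 2.2.9 (1)(a), (b) (`SO_n`, `Sp_{2n}` connected); Exercise 2.2.2 (1) (`GL_n`
  connected).
* H. Lange, *Abelian Varieties over the Complex Numbers* (2023), §2.6.1 Proposition (the four Albert types with
  their restrictions), §7.2.4 Exercise (4) (`Lf(X)` = the connected component of the centraliser).

## What is proved (`X = E/Ψ(ℤ^κ)` SIMPLE, polarised by `η` with rational Gram matrix `G`, `K = Z(End⁰(X))`, `g ≤ 7`)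

* **`IsSimple.lefschetzIdentityC_classicalPowers_of_finrank_le_seven`** — EITHER type I and
  `Lf(X)(ℂ) ≃* Sp_{2n}(ℂ)^{Hom(K,ℂ)}` (`n·[K:ℚ] = g`), OR type II and `Lf(X)(ℂ) ≃* Sp_{2n}(ℂ)^{InfinitePlace K}`
  (`4n·[K:ℚ] = 2g`), OR type III and `Lf(X)(ℂ) ≃* SO_m(ℂ)^{Fin [K:ℚ]}` (`2m·[K:ℚ] = 2g`), OR type IV and
  `Lf(X)(ℂ) ≃* GL_m(ℂ)^{InfinitePlace K}` (`d·m·[K:ℚ] = 2g`): the identity component is always a power of a CONNECTED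
  classical group (only the type III row differs from the «Group» column, `SO` for `O`).
* **`IsSimple.relIndex_lefschetzIdentityC_lefschetzGroupC_of_finrank_le_seven`** — the «Connected» column as a
  number: `[S(X)(ℂ) : Lf(X)(ℂ)] = 1` if `X` is not of type III and `= 2^{[K:ℚ]}` if it is; with the corollaries
  `IsSimple.relIndex_lefschetzIdentityC_lefschetzGroupC_eq_one_iff_not_isAlbertTypeIII_of_finrank_le_seven` and
  `IsSimple.relIndex_lefschetzIdentityC_lefschetzGroupC_eq_one_of_odd` (odd `g ≤ 7`).

NOT here: `g ≥ 8` (Albert's theorem for every `g`); given the type, the per-type theorems hold in every dimension.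
-/

open Module Matrix NumberField
open Literature.RingTheory.CentralSimple (IsAlbertTypeI IsAlbertTypeII IsAlbertTypeIII IsAlbertTypeIV)

namespace Literature.Geometry.Kaehler

namespace ComplexTorus

section Simple

variable {κ : Type} [Fintype κ] [DecidableEq κ] [Nonempty κ] {E : Type} [NormedAddCommGroup E] [NormedSpace ℂ E]
  [FiniteDimensional ℂ E] {Ψ : (κ → ℝ) ≃L[ℝ] E} {η : E [⋀^Fin 2]→L[ℝ] ℝ} {G : Matrix κ κ ℚ}

/-- **LANGE'S `Lf(X)(ℂ) = S(X)(ℂ)⁰` FOR EVERY SIMPLE POLARISED COMPLEX TORUS OF DIMENSION `g ≤ 7` IS `f` COPIES OF A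
CONNECTED CLASSICAL GROUP**, with `K = Z(End⁰(X))`: (I) `Lf(X)(ℂ) ≃* Sp_{2n}(ℂ)^{Hom(K,ℂ)}`, `n · [K:ℚ] = g`;
(II) `Lf(X)(ℂ) ≃* Sp_{2n}(ℂ)^{InfinitePlace K}`, `4n · [K:ℚ] = 2g`; (III) `Lf(X)(ℂ) ≃* SO_m(ℂ)^{Fin [K:ℚ]}`,
`2m · [K:ℚ] = 2g` — the identity component of «III ∣ O_{g/f} ∣ Connected: No» («`SO_n` is the identity component of
`O_n`»); (IV) `Lf(X)(ℂ) ≃* GL_m(ℂ)^{InfinitePlace K}`, `d · m · [K:ℚ] = 2g`, `d = √[End⁰(X):K]`; `2g = #κ`.  For types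
I, II, IV this is the «Group» column itself (`Lf = S`, «Connected: Yes»).
[cite: Milne1999LefschetzClasses, §2 Summary table (p. 652: «I ∣ Sp_{2g/f} ∣ Yes ∣ Yes; II ∣ Sp_{g/f} ∣ Yes ∣ Yes; III ∣ O_{g/f} ∣ Yes ∣ No; IV ∣ GL_{g/(df)} ∣ No ∣ Yes», «`f` copies») and Remark 4.9 (p. 660–661)]
[cite: Springer1998, Exercises 2.2.2 (1), (2)(b) and 2.2.9 (1)] [cite: Lange2023AbelianVarietiesComplex, §2.6.1 Proposition and §7.2.4 Exercise (4)] -/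
theorem IsSimple.lefschetzIdentityC_classicalPowers_of_finrank_le_seven (hX : IsSimple Ψ) (hη : IsRiemannForm Ψ η)
    (hG : G.map (Rat.cast : ℚ → ℝ) = latticeGram Ψ η) (hg : finrank ℂ E ≤ 7) :
    (IsAlbertTypeI (centerField Ψ hX) (endAlgRat Ψ) (rosatiEnd Ψ hη.1 hη.2.2 hG) ∧
      ∃ n : ℕ, n * finrank ℚ (centerField Ψ hX) = finrank ℂ E ∧
        Nonempty (lefschetzIdentityC Ψ G ≃* ((centerField Ψ hX →+* ℂ) → symplecticGroupC (Fin n)))) ∨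
    (IsAlbertTypeII (centerField Ψ hX) (endAlgRat Ψ) (rosatiEnd Ψ hη.1 hη.2.2 hG) ∧
      ∃ n : ℕ, 4 * n * finrank ℚ (centerField Ψ hX) = Fintype.card κ ∧
        Nonempty (lefschetzIdentityC Ψ G ≃* (InfinitePlace (centerField Ψ hX) → symplecticGroupC (Fin n)))) ∨
    (IsAlbertTypeIII (centerField Ψ hX) (endAlgRat Ψ) (rosatiEnd Ψ hη.1 hη.2.2 hG) ∧
      ∃ m : ℕ, 2 * m * finrank ℚ (centerField Ψ hX) = Fintype.card κ ∧
        Nonempty (lefschetzIdentityC Ψ G ≃*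
          (Fin (finrank ℚ (centerField Ψ hX)) → Matrix.specialOrthogonalGroup (Fin m) ℂ))) ∨
    (IsAlbertTypeIV (centerField Ψ hX) (endAlgRat Ψ) (rosatiEnd Ψ hη.1 hη.2.2 hG) ∧
      ∃ m : ℕ, Nat.sqrt (finrank (centerField Ψ hX) (endAlgRat Ψ)) * m * finrank ℚ (centerField Ψ hX) =
          Fintype.card κ ∧
        Nonempty (lefschetzIdentityC Ψ G ≃* (InfinitePlace (centerField Ψ hX) → GL (Fin m) ℂ))) := by
  rcases hX.isAlbertType_of_finrank_le_seven hη hG hg with h | h | h | h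
  · refine Or.inl ⟨h, ?_⟩
    obtain ⟨n, hn, -, hiso⟩ := hX.nonempty_lefschetzIdentityC_mulEquiv_pi_symplecticGroupC_of_isAlbertTypeI hη hG h
    exact ⟨n, hn, hiso⟩
  · exact Or.inr (Or.inl ⟨h, hX.nonempty_lefschetzIdentityC_mulEquiv_fun_symplecticGroupC_of_isAlbertTypeII hη hG h⟩)
  · exact Or.inr (Or.inr (Or.inl
      ⟨h, hX.nonempty_lefschetzIdentityC_mulEquiv_fun_specialOrthogonalGroup_of_isAlbertTypeIII hη hG h⟩))
  · exact Or.inr (Or.inr (Or.inr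
      ⟨h, hX.nonempty_lefschetzIdentityC_mulEquiv_fun_generalLinearGroup_of_isAlbertTypeIV hη hG h⟩))

/-- **ODD DIMENSION `g ≤ 7`: `Lf(X)(ℂ) = S(X)(ℂ) ≃* Sp_{2n}(ℂ)^{Hom(K,ℂ)}` (type I) or `≃* GL_m(ℂ)^{InfinitePlace K}` (type IV,
`d = 1`)** — no orthogonal factors in odd dimension. [cite: Milne1999LefschetzClasses, §2 Summary table (p. 652)]
[cite: MoonenZarhin1999LowDim, §2 («a simple `X` of prime dimension cannot be of Type 3»)]
[cite: Lange2023AbelianVarietiesComplex, §2.6.1 Proposition («restriction» column) and §7.2.4 Exercise (4)] -/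
theorem IsSimple.lefschetzIdentityC_symplectic_or_linearPowers_of_odd (hX : IsSimple Ψ) (hη : IsRiemannForm Ψ η)
    (hG : G.map (Rat.cast : ℚ → ℝ) = latticeGram Ψ η) (hg : finrank ℂ E ≤ 7) (hodd : Odd (finrank ℂ E)) :
    (IsAlbertTypeI (centerField Ψ hX) (endAlgRat Ψ) (rosatiEnd Ψ hη.1 hη.2.2 hG) ∧
      ∃ n : ℕ, n * finrank ℚ (centerField Ψ hX) = finrank ℂ E ∧
        Nonempty (lefschetzIdentityC Ψ G ≃* ((centerField Ψ hX →+* ℂ) → symplecticGroupC (Fin n)))) ∨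
    (IsAlbertTypeIV (centerField Ψ hX) (endAlgRat Ψ) (rosatiEnd Ψ hη.1 hη.2.2 hG) ∧
      finrank (centerField Ψ hX) (endAlgRat Ψ) = 1 ∧
      ∃ m : ℕ, m * finrank ℚ (centerField Ψ hX) = Fintype.card κ ∧
        Nonempty (lefschetzIdentityC Ψ G ≃* (InfinitePlace (centerField Ψ hX) → GL (Fin m) ℂ))) := by
  obtain ⟨h | h, h1⟩ := hX.isAlbertTypeI_or_isAlbertTypeIV_of_odd hη hG hg hodd
  · refine Or.inl ⟨h, ?_⟩
    obtain ⟨n, hn, -, hiso⟩ := hX.nonempty_lefschetzIdentityC_mulEquiv_pi_symplecticGroupC_of_isAlbertTypeI hη hG h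
    exact ⟨n, hn, hiso⟩
  · refine Or.inr ⟨h, h1, ?_⟩
    obtain ⟨m, hm, hiso⟩ := hX.nonempty_lefschetzIdentityC_mulEquiv_fun_generalLinearGroup_of_isAlbertTypeIV hη hG h
    refine ⟨m, ?_, hiso⟩
    rw [h1, Nat.sqrt_one, one_mul] at hm
    exact hm

/-- **THE «CONNECTED» COLUMN AS A NUMBER, `g ≤ 7`: `[S(X)(ℂ) : Lf(X)(ℂ)] = 1` if `X` is not of Albert type III, and
`= 2^{[K:ℚ]} = 2^f` if it is** (the component group of «III ∣ O_{g/f} ∣ Connected: No» is `(ℤ/2)^f`).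
[cite: Milne1999LefschetzClasses, §2 Summary table (p. 652: «Connected: Yes ∣ Yes ∣ No ∣ Yes») and Remark 4.9 (p. 660–661)]
[cite: Springer1998, Exercises 2.2.2 (2) and 2.2.9 (2)] [cite: Lange2023AbelianVarietiesComplex, §2.6.1 Proposition and §7.2.4 Exercise (4)] -/
theorem IsSimple.relIndex_lefschetzIdentityC_lefschetzGroupC_of_finrank_le_seven (hX : IsSimple Ψ)
    (hη : IsRiemannForm Ψ η) (hG : G.map (Rat.cast : ℚ → ℝ) = latticeGram Ψ η) (hg : finrank ℂ E ≤ 7) :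
    (¬ IsAlbertTypeIII (centerField Ψ hX) (endAlgRat Ψ) (rosatiEnd Ψ hη.1 hη.2.2 hG) →
        (lefschetzIdentityC Ψ G).relIndex (lefschetzGroupC Ψ G) = 1) ∧
      (IsAlbertTypeIII (centerField Ψ hX) (endAlgRat Ψ) (rosatiEnd Ψ hη.1 hη.2.2 hG) →
        (lefschetzIdentityC Ψ G).relIndex (lefschetzGroupC Ψ G) = 2 ^ finrank ℚ (centerField Ψ hX)) := by
  refine ⟨fun hIII ↦ ?_, fun hIII ↦ hX.relIndex_lefschetzIdentityC_lefschetzGroupC_of_isAlbertTypeIII hη hG hIII⟩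
  rw [hX.lefschetzIdentityC_eq_lefschetzGroupC_of_not_isAlbertTypeIII' hη hG hg hIII, Subgroup.relIndex_self]

/-- **`g ≤ 7`: `[S(X)(ℂ) : Lf(X)(ℂ)] = 1 ⟺ X` is not of Albert type III.** [cite: Milne1999LefschetzClasses, §2 Summary table (p. 652) and Remark 4.9]
[cite: Lange2023AbelianVarietiesComplex, §2.6.1 Proposition and §7.2.4 Exercise (4)] -/
theorem IsSimple.relIndex_lefschetzIdentityC_lefschetzGroupC_eq_one_iff_not_isAlbertTypeIII_of_finrank_le_seven
    (hX : IsSimple Ψ) (hη : IsRiemannForm Ψ η) (hG : G.map (Rat.cast : ℚ → ℝ) = latticeGram Ψ η)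
    (hg : finrank ℂ E ≤ 7) :
    (lefschetzIdentityC Ψ G).relIndex (lefschetzGroupC Ψ G) = 1 ↔
      ¬ IsAlbertTypeIII (centerField Ψ hX) (endAlgRat Ψ) (rosatiEnd Ψ hη.1 hη.2.2 hG) := by
  rw [Subgroup.relIndex_eq_one, ← hX.lefschetzIdentityC_eq_lefschetzGroupC_iff_not_isAlbertTypeIII' hη hG hg]
  exact ⟨fun h ↦ le_antisymm (lefschetzIdentityC_le Ψ G) h, fun h ↦ h.symm.le⟩

/-- **Odd `g ≤ 7`: `[S(X)(ℂ) : Lf(X)(ℂ)] = 1`** (no type III in odd dimension). [cite: MoonenZarhin1999LowDim, §2]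
[cite: Milne1999LefschetzClasses, §2 Summary table (p. 652)] -/
theorem IsSimple.relIndex_lefschetzIdentityC_lefschetzGroupC_eq_one_of_odd (hX : IsSimple Ψ) (hη : IsRiemannForm Ψ η)
    (hG : G.map (Rat.cast : ℚ → ℝ) = latticeGram Ψ η) (hg : finrank ℂ E ≤ 7) (hodd : Odd (finrank ℂ E)) :
    (lefschetzIdentityC Ψ G).relIndex (lefschetzGroupC Ψ G) = 1 := by
  rw [hX.lefschetzIdentityC_eq_lefschetzGroupC_of_odd hη hG hg hodd, Subgroup.relIndex_self]

end Simple

end ComplexTorus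

end Literature.Geometry.Kaehler
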